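import Summits.Ventures.HSemireg.ObstructionLocusBlockDevissageExt
import Summits.Ventures.HSemireg.ObstructionLocusBlockPoint

/-!
# Venture HSemireg — (S5) OBSTRUCTION LOCUS away from secant type, XXX: EXT-NOTE §6.A at CROSSING germs —
# `pd_R I_M = r` EXACTLY for a block model with `r` blocks, by the dévissage (no tensor-product resolution)

HONEST FRAMING.  Part of the Lean side of the computation cell `pub-hsemireg` (track «S4-PUSH» (ii), seat
s4-prove-2; files XXVII–XXX, the dévissage is summarised in the module docstring of file XXVII
`ObstructionLocusBlockDevissage`).  Plain commutative / homological algebra in `R = MvPolynomial (Fin n) K`, every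
`n`, EVERY commutative ring `K` (non-trivial for the lower bound), with Mathlib's derived `CategoryTheory.Abelian.Ext`
in `ModuleCat R` and `HasProjectiveDimensionLT` / `projectiveDimension`.  Nothing here constructs a variety or a
sheaf; nothing here says that HC / HC_CM / HC_AV holds; no Literature fact is declared or used; no object is
certified.  EXT-NOTE §6.A computes `pd_R I_M = r` at a crossing germ `M(S_1, …, S_r)` from the tensor product of the
`r` block Hilbert–Burch resolutions (exactness by Künneth); files XXV–XXVI had this only for ONE block (`pd = 1`).
Here both inequalities follow from the dévissage `0 → V^{S∖a₀} →Φ_V V^S →E I_S ∩ V → 0` of file XXVII by induction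
on the number of blocks: the upper bound by two-out-of-three, the lower bound because every entry of `Φ_V` is
`± x_c`, so `Φ_V^* = 0` on `Ext(·, k)`, `k = R/(x_1, …, x_n)`, and the connecting map
`∂ : Ext^{r−1}(V^{S∖a₀}, k) ↪ Ext^r(I_M, k)` is injective — a non-zero class survives from `Hom_R(R, k) ∋ 1`.

* `ext_pi_eq_sum` (`ζ = Σ_a [pr_a] ∘ [ι_a] ∘ ζ` on `V^S`), `hasProjectiveDimensionLT_pi` (`pd V^S ≤ pd V`);
* `hasProjectiveDimensionLT_inf` (the dévissage step), `hasProjectiveDimensionLT_of_card`,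
  **`hasProjectiveDimensionLE_arrIdeal` : `pd_R I_M ≤ r`** for EVERY block model with `r` blocks (any `K`),
  `ext_arrIdeal_subsingleton_of_card_lt` (`Ext^{>r}_R(I_M, −) = 0`);
* `originIdeal`, `residueModule` (`k = R/(x_1,…,x_n)`), `one_notMem_originIdeal`, `X_smul_ext_residue_eq_zero`
  (`x_c · Ext(·, k) = 0`), **`mk₀_hbMap_comp_eq_zero`** (`Φ_V^* = 0` on `Ext(·, k)`),
  `eq_zero_of_extClass_comp_eq_zero` (`∂` injective), `exists_ext_top_ne_zero`, **`exists_ext_ne_zero_of_card`**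
  (`Ext^r_R(I_M, k) ≠ 0` when all `r` blocks have size `≥ 2`, `K` non-trivial);
* **`projectiveDimension_arrIdeal_eq_card` : `projectiveDimension (I_M) = r`** for every block model with `r` blocks
  all of size `≥ 2` (at a point `q` of a (GEN) arrangement the blocks `S_t(q)` of the translates through `q` have
  size `≥ 2`, file XXIV), every `n`, every non-trivial commutative `K`; `projectiveDimension_arrIdeal_ofPoint`:
  at a point `q` of a (GEN) arrangement, `pd = #(translates through q)` for file XXIV's `Blocks.ofPoint`.
References (dictionary only): EXT-NOTE.md §6.0, §6.A («`pd_R I_{K_S} = 1`», «the tensor product of the resolutions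
… length `r`»); G2-REDUCIBLE-POINT-THEOREM.md §2.  The argument is standard homological algebra, not from a source.
-/

open CategoryTheory CategoryTheory.Abelian MvPolynomial Finset
open scoped BigOperators

universe u

namespace Summit.Ventures.HSemireg.ObstructionLocus.BlockModel

variable {K : Type u} [CommRing K] {n : ℕ}

/-! ## `Ext` out of a finite power `V^S` -/

/-- Decomposition of a class on `V^S` along `𝟙 = Σ_a ι_a ∘ pr_a`: `ζ = Σ_a [pr_a] ∘ ([ι_a] ∘ ζ)`. -/
theorem ext_pi_eq_sum {V : Ideal (MvPolynomial (Fin n) K)} (S : Finset (Fin n))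
    {Y : ModuleCat.{u} (MvPolynomial (Fin n) K)} {i : ℕ}
    (ζ : Ext.{u} (ModuleCat.of (MvPolynomial (Fin n) K) (↥S → ↥V)) Y i) :
    ζ = ∑ a : ↥S, (Ext.mk₀ (ModuleCat.ofHom (LinearMap.proj a))).comp
      ((Ext.mk₀ (ModuleCat.ofHom (LinearMap.single (MvPolynomial (Fin n) K) (fun _ : ↥S => ↥V) a))).comp ζ
        (zero_add i)) (zero_add i) := by
  classical
  have hid : (𝟙 (ModuleCat.of (MvPolynomial (Fin n) K) (↥S → ↥V))) =
      ∑ a : ↥S, ModuleCat.ofHom (LinearMap.proj a) ≫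
        ModuleCat.ofHom (LinearMap.single (MvPolynomial (Fin n) K) (fun _ : ↥S => ↥V) a) := by
    apply ModuleCat.hom_ext
    rw [ModuleCat.hom_id, ModuleCat.hom_sum]
    apply LinearMap.ext
    intro x
    rw [LinearMap.id_apply, LinearMap.sum_apply]
    conv_lhs => rw [← Finset.univ_sum_single x]
    refine Finset.sum_congr rfl fun a _ => ?_
    rfl
  conv_lhs => rw [← Ext.mk₀_id_comp ζ, hid, Ext.mk₀_sum, Ext.sum_comp]
  refine Finset.sum_congr rfl fun a _ => ?_
  rw [← Ext.mk₀_comp_mk₀, Ext.comp_assoc_of_second_deg_zero]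

/-- `pd_R V < m ⟹ pd_R V^S < m`. -/
theorem hasProjectiveDimensionLT_pi {V : Ideal (MvPolynomial (Fin n) K)} (S : Finset (Fin n)) (m : ℕ)
    (hV : HasProjectiveDimensionLT (ModuleCat.of (MvPolynomial (Fin n) K) ↥V) m) :
    HasProjectiveDimensionLT (ModuleCat.of (MvPolynomial (Fin n) K) (↥S → ↥V)) m := by
  haveI := hV
  rw [hasProjectiveDimensionLT_iff]
  intro i hi Y e
  rw [ext_pi_eq_sum S e]
  refine Finset.sum_eq_zero fun a _ => ?_
  rw [((Ext.mk₀ (ModuleCat.ofHom (LinearMap.single (MvPolynomial (Fin n) K) (fun _ : ↥S => ↥V) a))).comp e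
    (zero_add i)).eq_zero_of_hasProjectiveDimensionLT m hi, Ext.comp_zero]

/-! ## Upper bound: `pd_R I_M ≤ r` for a block model with `r` blocks -/

/-- Transport of `HasProjectiveDimensionLT` along an equality of ideals. -/
theorem hasProjectiveDimensionLT_congr {J J' : Ideal (MvPolynomial (Fin n) K)} (h : J = J') (m : ℕ)
    (hJ : HasProjectiveDimensionLT (ModuleCat.of (MvPolynomial (Fin n) K) ↥J) m) :
    HasProjectiveDimensionLT (ModuleCat.of (MvPolynomial (Fin n) K) ↥J') m := by
  subst h; exact hJ

/-- The unit ideal is projective: `pd_R R < 1`. -/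
theorem hasProjectiveDimensionLT_top :
    HasProjectiveDimensionLT (ModuleCat.of (MvPolynomial (Fin n) K) ↥(⊤ : Ideal (MvPolynomial (Fin n) K))) 1 := by
  haveI : Module.Projective (MvPolynomial (Fin n) K) ↥(⊤ : Ideal (MvPolynomial (Fin n) K)) :=
    Module.Projective.of_equiv (Submodule.topEquiv.symm :
      MvPolynomial (Fin n) K ≃ₗ[MvPolynomial (Fin n) K] ↥(⊤ : Ideal (MvPolynomial (Fin n) K)))
  infer_instance

/-- **The dévissage bounds the projective dimension**: `pd_R V < m ⟹ pd_R (I_S ∩ V) < m + 1`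
(`0 → V^{S∖a₀} → V^S → I_S ∩ V → 0`, two-out-of-three). -/
theorem hasProjectiveDimensionLT_inf (S : Finset (Fin n)) {a₀ : Fin n} (ha₀ : a₀ ∈ S)
    (V : Ideal (MvPolynomial (Fin n) K))
    (hV : ∀ a ∈ S, ∀ s : MvPolynomial (Fin n) K, X a * s ∈ V → s ∈ V)
    (hUV : blockIdeal K S ⊓ V ≤ blockIdeal K S * V) (m : ℕ)
    (hP : HasProjectiveDimensionLT (ModuleCat.of (MvPolynomial (Fin n) K) ↥V) m) :
    HasProjectiveDimensionLT (ModuleCat.of (MvPolynomial (Fin n) K) ↥(blockIdeal K S ⊓ V)) (m + 1) :=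
  (devissage_shortExact S V ha₀ hV hUV).hasProjectiveDimensionLT_X₃ m
    (hasProjectiveDimensionLT_pi (S.erase a₀) m hP)
    (haveI := hasProjectiveDimensionLT_pi S m hP
     hasProjectiveDimensionLT_of_ge _ m (m + 1) (Nat.le_succ m))

/-- `pd_R I_M ≤ k` for every block model with `k` blocks (induction on `k`). -/
theorem hasProjectiveDimensionLT_of_card (k : ℕ) :
    ∀ {ι : Type*} [Fintype ι] (B : Blocks ι n), Fintype.card ι = k →
      HasProjectiveDimensionLT (ModuleCat.of (MvPolynomial (Fin n) K) ↥(arrIdeal K B)) (k + 1) := by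
  induction k with
  | zero =>
    intro ι _ B hk
    haveI : IsEmpty ι := Fintype.card_eq_zero_iff.1 hk
    exact hasProjectiveDimensionLT_congr (arrIdeal_eq_top_of_isEmpty B).symm 1 hasProjectiveDimensionLT_top
  | succ k ih =>
    intro ι _ B hk
    classical
    obtain ⟨i₀⟩ : Nonempty ι := Fintype.card_pos_iff.1 (by omega)
    have hcard : Fintype.card {i // i ≠ i₀} = k := by
      rw [Fintype.card_subtype, Finset.filter_ne', Finset.card_erase_of_mem (Finset.mem_univ _),
        Finset.card_univ, hk]
      rfl
    have hS := disjoint_allBlocks_restrict B i₀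
    obtain ⟨a₀, ha₀⟩ := B.nonempty i₀
    exact hasProjectiveDimensionLT_congr (arrIdeal_eq_blockIdeal_inf_restrict B i₀).symm _
      (hasProjectiveDimensionLT_inf (B.S i₀) ha₀ (arrIdeal K (B.restrict (· ≠ i₀))) (X_mul_mem_arrIdeal_imp hS)
        (blockIdeal_inf_arrIdeal_restrict_le_mul B i₀) (k + 1) (ih _ hcard))

variable {ι : Type*} [Fintype ι]

/-- **`pd_R I_M ≤ r` for EVERY block model `M(S_1, …, S_r)`** (EXT-NOTE §6.A at crossing germs, upper bound:
«the tensor product of the `r` block resolutions has length `r`»; here by the dévissage), every `n`, every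
commutative `K`: `HasProjectiveDimensionLE (I_M) (#blocks)`. -/
theorem hasProjectiveDimensionLE_arrIdeal (B : Blocks ι n) :
    HasProjectiveDimensionLE (ModuleCat.of (MvPolynomial (Fin n) K) ↥(arrIdeal K B)) (Fintype.card ι) :=
  hasProjectiveDimensionLT_of_card _ B rfl

/-- Hence `Ext^i_R(I_M, N) = 0` for `i > r` and every `N`. -/
theorem ext_arrIdeal_subsingleton_of_card_lt (B : Blocks ι n) (N : ModuleCat.{u} (MvPolynomial (Fin n) K))
    {i : ℕ} (hi : Fintype.card ι < i) :
    Subsingleton (Ext.{u} (ModuleCat.of (MvPolynomial (Fin n) K) ↥(arrIdeal K B)) N i) :=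
  haveI := hasProjectiveDimensionLE_arrIdeal (K := K) B
  HasProjectiveDimensionLT.subsingleton _ (Fintype.card ι + 1) i hi N

/-! ## Lower bound: `Ext^r_R(I_M, k) ≠ 0` against the residue module `k = R/(x_1, …, x_n)` -/

variable (K n) in
/-- The ideal of the origin `(x_1, …, x_n)`. -/
noncomputable abbrev originIdeal : Ideal (MvPolynomial (Fin n) K) :=
  Ideal.span (Set.range (X : Fin n → MvPolynomial (Fin n) K))

variable (K n) in
/-- The residue module at the origin `k = R/(x_1, …, x_n)` as an object of `ModuleCat R`. -/
noncomputable abbrev residueModule : ModuleCat.{u} (MvPolynomial (Fin n) K) :=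
  ModuleCat.of (MvPolynomial (Fin n) K) (MvPolynomial (Fin n) K ⧸ originIdeal K n)

/-- `1 ∉ (x_1, …, x_n)` over a non-trivial `K`. -/
theorem one_notMem_originIdeal [Nontrivial K] : (1 : MvPolynomial (Fin n) K) ∉ originIdeal K n := by
  intro h
  rw [originIdeal, ← Set.image_univ, mem_ideal_span_X_image] at h
  have h1 := h 0 (by simp)
  obtain ⟨c, -, hc⟩ := h1
  simp at hc

/-- The variables act by `0` on every `Ext^i_R(X, k)`. -/
theorem X_smul_ext_residue_eq_zero {X' : ModuleCat.{u} (MvPolynomial (Fin n) K)} {i : ℕ} (c : Fin n)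
    (e : Ext.{u} X' (residueModule K n) i) : (X c : MvPolynomial (Fin n) K) • e = 0 := by
  rw [Ext.smul_eq_comp_mk₀]
  have : (X c : MvPolynomial (Fin n) K) • 𝟙 (residueModule K n) = 0 := by
    apply ModuleCat.hom_ext
    apply LinearMap.ext
    intro v
    obtain ⟨p, rfl⟩ := Ideal.Quotient.mk_surjective v
    change (X c : MvPolynomial (Fin n) K) • Ideal.Quotient.mk (originIdeal K n) p = 0
    rw [smul_mk_eq, Ideal.Quotient.eq_zero_iff_mem]
    exact Ideal.mul_mem_right _ _ (Ideal.subset_span ⟨c, rfl⟩)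
  rw [this, Ext.mk₀_zero, Ext.comp_zero]

/-- **`Φ_V^* = 0` on `Ext(·, k)`**: every entry of the Hilbert–Burch matrix is `± x_c`, which kills `Ext(·, k)`. -/
theorem mk₀_hbMap_comp_eq_zero (S : Finset (Fin n)) (a₀ : Fin n) (V : Ideal (MvPolynomial (Fin n) K)) {i : ℕ}
    (w : Ext.{u} (ModuleCat.of (MvPolynomial (Fin n) K) (↥S → ↥V)) (residueModule K n) i) :
    (Ext.mk₀ (ModuleCat.ofHom (hbMap S a₀ V))).comp w (zero_add i) = 0 := by
  classical
  rw [ext_pi_eq_sum S w, Ext.comp_sum]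
  refine Finset.sum_eq_zero fun a _ => ?_
  rw [← Ext.comp_assoc_of_second_deg_zero, Ext.mk₀_comp_mk₀]
  by_cases h : (a : Fin n) = a₀
  · have hfac : ModuleCat.ofHom (hbMap S a₀ V) ≫ ModuleCat.ofHom (LinearMap.proj a) =
        -((X a₀ : MvPolynomial (Fin n) K) •
          ModuleCat.ofHom (∑ b : ↥(S.erase a₀), (LinearMap.proj b : (↥(S.erase a₀) → ↥V) →ₗ[_] ↥V))) := by
      apply ModuleCat.hom_ext
      apply LinearMap.ext
      intro x
      rw [ModuleCat.hom_comp, ModuleCat.hom_ofHom, ModuleCat.hom_ofHom, LinearMap.comp_apply,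
        LinearMap.proj_apply, hbMap_apply_of_eq S a₀ V x a h, ModuleCat.hom_neg, ModuleCat.hom_smul,
        ModuleCat.hom_ofHom, LinearMap.neg_apply, LinearMap.smul_apply, LinearMap.sum_apply]
      rfl
    rw [hfac, Ext.mk₀_neg, Ext.neg_comp, Ext.mk₀_smul, Ext.smul_comp, X_smul_ext_residue_eq_zero, neg_zero]
  · have hfac : ModuleCat.ofHom (hbMap S a₀ V) ≫ ModuleCat.ofHom (LinearMap.proj a) =
        (X (a : Fin n) : MvPolynomial (Fin n) K) •
          ModuleCat.ofHom (LinearMap.proj (⟨a, Finset.mem_erase.2 ⟨h, a.2⟩⟩ : ↥(S.erase a₀))) := by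
      apply ModuleCat.hom_ext
      apply LinearMap.ext
      intro x
      rw [ModuleCat.hom_comp, ModuleCat.hom_ofHom, ModuleCat.hom_ofHom, LinearMap.comp_apply,
        LinearMap.proj_apply, hbMap_apply_of_ne S a₀ V x a h, ModuleCat.hom_smul, ModuleCat.hom_ofHom,
        LinearMap.smul_apply, LinearMap.proj_apply]
    rw [hfac, Ext.mk₀_smul, Ext.smul_comp, X_smul_ext_residue_eq_zero]

/-- Hence **the connecting map `∂ : Ext^i(V^{S∖a₀}, k) → Ext^{i+1}(I_S ∩ V, k)` of the dévissage is injective**. -/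
theorem eq_zero_of_extClass_comp_eq_zero (S : Finset (Fin n)) {a₀ : Fin n} (ha₀ : a₀ ∈ S)
    (V : Ideal (MvPolynomial (Fin n) K))
    (hV : ∀ a ∈ S, ∀ s : MvPolynomial (Fin n) K, X a * s ∈ V → s ∈ V)
    (hUV : blockIdeal K S ⊓ V ≤ blockIdeal K S * V) {i : ℕ}
    (w : Ext.{u} (ModuleCat.of (MvPolynomial (Fin n) K) (↥(S.erase a₀) → ↥V)) (residueModule K n) i)
    (hw : (devissage_shortExact S V ha₀ hV hUV).extClass.comp w (show 1 + i = i + 1 by omega) = 0) : w = 0 := by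
  obtain ⟨x₂, hx₂⟩ := Ext.contravariant_sequence_exact₁ (devissage_shortExact S V ha₀ hV hUV) _ w _ hw
  rw [← hx₂]
  exact mk₀_hbMap_comp_eq_zero S a₀ V x₂

/-- Transport of «`Ext^i(J, k)` has a non-zero class» along an equality of ideals. -/
theorem exists_ext_ne_zero_congr {J J' : Ideal (MvPolynomial (Fin n) K)} (h : J = J') {i : ℕ}
    (hJ : ∃ e : Ext.{u} (ModuleCat.of (MvPolynomial (Fin n) K) ↥J) (residueModule K n) i, e ≠ 0) :
    ∃ e : Ext.{u} (ModuleCat.of (MvPolynomial (Fin n) K) ↥J') (residueModule K n) i, e ≠ 0 := by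
  subst h; exact hJ

/-- Base of the induction: `Hom_R(R, k) ≠ 0` (`K` non-trivial). -/
theorem exists_ext_top_ne_zero [Nontrivial K] :
    ∃ e : Ext.{u} (ModuleCat.of (MvPolynomial (Fin n) K) ↥(⊤ : Ideal (MvPolynomial (Fin n) K)))
      (residueModule K n) 0, e ≠ 0 := by
  refine ⟨Ext.mk₀ (ModuleCat.ofHom ((originIdeal K n).mkQ ∘ₗ (⊤ : Ideal (MvPolynomial (Fin n) K)).subtype)), ?_⟩
  rw [Ne, Ext.mk₀_eq_zero_iff]
  intro h
  have h1 := LinearMap.congr_fun (congr_arg ModuleCat.Hom.hom h) ⟨1, Submodule.mem_top⟩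
  rw [ModuleCat.hom_ofHom, LinearMap.comp_apply, Submodule.subtype_apply, Submodule.mkQ_apply,
    ModuleCat.hom_zero, LinearMap.zero_apply, Submodule.Quotient.mk_eq_zero] at h1
  exact one_notMem_originIdeal h1

/-- **The induction: `Ext^r_R(I_M, k) ≠ 0` for a block model with `r` blocks, all of size `≥ 2`** (`K` non-trivial):
from a non-zero class `e' ∈ Ext^{r−1}(V, k)` of the other blocks, `∂([pr_b] ∘ e') ≠ 0`. -/
theorem exists_ext_ne_zero_of_card [Nontrivial K] (k : ℕ) :
    ∀ {ι : Type*} [Fintype ι] (B : Blocks ι n), Fintype.card ι = k → (∀ i, 2 ≤ (B.S i).card) →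
      ∃ e : Ext.{u} (ModuleCat.of (MvPolynomial (Fin n) K) ↥(arrIdeal K B)) (residueModule K n) k, e ≠ 0 := by
  induction k with
  | zero =>
    intro ι _ B hk _
    haveI : IsEmpty ι := Fintype.card_eq_zero_iff.1 hk
    exact exists_ext_ne_zero_congr (arrIdeal_eq_top_of_isEmpty B).symm exists_ext_top_ne_zero
  | succ k ih =>
    intro ι _ B hk h2
    classical
    obtain ⟨i₀⟩ : Nonempty ι := Fintype.card_pos_iff.1 (by omega)
    have hcard : Fintype.card {i // i ≠ i₀} = k := by
      rw [Fintype.card_subtype, Finset.filter_ne', Finset.card_erase_of_mem (Finset.mem_univ _),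
        Finset.card_univ, hk]
      rfl
    have hS := disjoint_allBlocks_restrict B i₀
    obtain ⟨a₀, ha₀, b₀, hb₀, hab⟩ := Finset.one_lt_card.1 (h2 i₀)
    have hb₀' : b₀ ∈ (B.S i₀).erase a₀ := Finset.mem_erase.2 ⟨fun h => hab h.symm, hb₀⟩
    set V := arrIdeal K (B.restrict (· ≠ i₀)) with hVdef
    obtain ⟨e', he'⟩ := ih (B.restrict (· ≠ i₀)) hcard fun i => h2 i.1
    have hT := devissage_shortExact (B.S i₀) V ha₀ (X_mul_mem_arrIdeal_imp hS)
      (blockIdeal_inf_arrIdeal_restrict_le_mul B i₀)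
    -- the class `[pr_{b₀}] ∘ e'` on `V^{S∖a₀}` is non-zero
    set w := (Ext.mk₀ (ModuleCat.ofHom (LinearMap.proj (⟨b₀, hb₀'⟩ : ↥((B.S i₀).erase a₀)) :
        (↥((B.S i₀).erase a₀) → ↥V) →ₗ[MvPolynomial (Fin n) K] ↥V))).comp e' (zero_add k) with hw
    have hw0 : w ≠ 0 := by
      intro h0
      apply he'
      have h1 : (Ext.mk₀ (ModuleCat.ofHom (LinearMap.single (MvPolynomial (Fin n) K)
          (fun _ : ↥((B.S i₀).erase a₀) => ↥V) ⟨b₀, hb₀'⟩))).comp w (zero_add k) = e' := by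
        rw [hw, ← Ext.comp_assoc_of_second_deg_zero, Ext.mk₀_comp_mk₀]
        have : ModuleCat.ofHom (LinearMap.single (MvPolynomial (Fin n) K) (fun _ : ↥((B.S i₀).erase a₀) => ↥V)
              ⟨b₀, hb₀'⟩) ≫ ModuleCat.ofHom (LinearMap.proj (⟨b₀, hb₀'⟩ : ↥((B.S i₀).erase a₀)) :
              (↥((B.S i₀).erase a₀) → ↥V) →ₗ[MvPolynomial (Fin n) K] ↥V) = 𝟙 _ := by
          apply ModuleCat.hom_ext
          apply LinearMap.ext
          intro v
          simp
        rw [this, Ext.mk₀_id_comp]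
      rw [← h1, h0, Ext.comp_zero]
    refine exists_ext_ne_zero_congr (arrIdeal_eq_blockIdeal_inf_restrict B i₀).symm
      ⟨hT.extClass.comp w (show 1 + k = k + 1 by omega), fun h0 => hw0 ?_⟩
    exact eq_zero_of_extClass_comp_eq_zero (B.S i₀) ha₀ V (X_mul_mem_arrIdeal_imp hS)
      (blockIdeal_inf_arrIdeal_restrict_le_mul B i₀) w h0

/-- **`pd_R I_M = r` EXACTLY for every block model with `r` blocks all of size `≥ 2`** — e.g. the germ of a (GEN)
arrangement at a crossing point of `r` translates (file XXIV: `|S_t(q)| ≥ 2` on `W + t`) — every `n`, every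
non-trivial commutative `K` (EXT-NOTE §6.A «`pd_R I_M = r`» at crossing germs; there by the tensor product of the
block resolutions), as Mathlib's `projectiveDimension` in `WithBot ℕ∞`. -/
theorem projectiveDimension_arrIdeal_eq_card [Nontrivial K] (B : Blocks ι n) (h2 : ∀ i, 2 ≤ (B.S i).card) :
    projectiveDimension (ModuleCat.of (MvPolynomial (Fin n) K) ↥(arrIdeal K B)) = Fintype.card ι := by
  apply le_antisymm
  · exact (projectiveDimension_le_iff _ _).2 (hasProjectiveDimensionLE_arrIdeal B)
  · refine (projectiveDimension_ge_iff _ _).2 fun hlt => ?_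
    obtain ⟨e, he⟩ := exists_ext_ne_zero_of_card (K := K) _ B rfl h2
    exact he (e.eq_zero_of_hasProjectiveDimensionLT _ le_rfl)

/-- **At a point `q` of a (GEN) arrangement `Z_T`, the local model has projective dimension EXACTLY the number of
translates through `q`**: `pd_R I_{M(q)} = #{t ∈ T : q ∈ W + t}` for file XXIV's block structure `Blocks.ofPoint q T`
(blocks `S_t(q)`, all of size `≥ 2`), every `n`, every non-trivial commutative `K` — `1` on exactly one translate,
`r` at a crossing point of `r` translates (EXT-NOTE §6.0/§6.A; the étale-local identification itself stays prose). -/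
theorem projectiveDimension_arrIdeal_ofPoint [Nontrivial K] {G : Type*} [DecidableEq G] (q : Fin n → G)
    (T : Finset (Fin n → G)) (hGEN : ∀ t ∈ T, ∀ t' ∈ T, t ≠ t' → ∀ k, t k ≠ t' k) :
    projectiveDimension (ModuleCat.of (MvPolynomial (Fin n) K) ↥(arrIdeal K (Blocks.ofPoint q T hGEN)))
      = (through q T).card := by
  rw [← Fintype.card_coe (through q T)]
  exact projectiveDimension_arrIdeal_eq_card _ fun t => (mem_through.1 t.2).2

end Summit.Ventures.HSemireg.ObstructionLocus.BlockModel
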